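import Summits.AnomalousDissipation.AnomalousDissipation.Theses.DyadicWallCascade
import Summits.AnomalousDissipation.AnomalousDissipation.Theorems.CoherentStatesSteadyNegTameOffThinSets
import HarnessLib

/-!
# Route DyadicWallCascade — crux `DyadicRealisation`, stub `stub_gateReduction`

The "gate reduction" step of the sketch for
`Summit.AnomalousDissipation.AnomalousDissipation.Theses.DyadicWallCascade.DyadicRealisation`
(item stmt-AnomalousDissipation-17918).

Given a smooth solenoidal mean-zero force `f`, a field `r` with `∫ ⟪f, w⟫ = ∫ ⟪r, w⟫` for every
smooth solenoidal `w` (i.e. `f` is the Leray projection of `r` tested against smooth solenoidal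
fields), a vanishing-viscosity family of steady classical Navier–Stokes states `u_j` driven by `f`
with a uniform energy bound, and a floor `ε ≤ ∫ ⟪r, u_j⟫`, the steady zeroth law holds with the
SAME data `f, ν, u, p`:

* the steady energy identity `ν_j ‖∇u_j‖₂² = ∫ ⟪f, u_j⟫`
  (`Theorems.CoherentStates.steady_energy_identity`);
* `u_j` is smooth (time slice of the jointly smooth velocity,
  `Torus.IsSmoothSpaceTimeOn.isSmooth_slice`) and solenoidal (`IsClassicalNSSolutionOn.divFree`),
  so the projection hypothesis at `w := u_j` gives `∫ ⟪f, u_j⟫ = ∫ ⟪r, u_j⟫ ≥ ε`.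
-/

set_option linter.dupNamespace false

namespace Summit.AnomalousDissipation.AnomalousDissipation.Theorems

open MeasureTheory Filter Set
open scoped InnerProductSpace
open Literature.Analysis.FunctionSpaces
open Summit.AnomalousDissipation.AnomalousDissipation.Theorems.CoherentStates (steady_energy_identity)

/-- **Gate reduction.** If `f` agrees with `r` when tested against smooth solenoidal fields, then
along any family of steady classical Navier–Stokes states `u_j` of `NS_{ν_j}(f)` the dissipation
`ν_j ‖∇u_j‖₂²` equals `∫ ⟪f, u_j⟫ = ∫ ⟪r, u_j⟫` (steady energy identity, then the projection
hypothesis at the smooth solenoidal slice `w := u_j`); hence a floor `ε ≤ ∫ ⟪r, u_j⟫` is a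
dissipation floor, and the steady zeroth law holds with the same `f, ν, u, p`. [folklore] -/
theorem stub_gateReduction : ∀ (f r : UnitAddTorus (Fin 3) → EuclideanSpace ℝ (Fin 3)),
    Literature.Analysis.FunctionSpaces.Torus.IsSmooth f →
    Literature.Analysis.FunctionSpaces.Torus.IsDivFree f →
    Literature.Analysis.FunctionSpaces.Torus.HasZeroMean f →
    (∀ w : UnitAddTorus (Fin 3) → EuclideanSpace ℝ (Fin 3),
      Literature.Analysis.FunctionSpaces.Torus.IsSmooth w →
      Literature.Analysis.FunctionSpaces.Torus.IsDivFree w →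
      ∫ x, ⟪f x, w x⟫_ℝ = ∫ x, ⟪r x, w x⟫_ℝ) →
    ∀ (ν : ℕ → ℝ) (u : ℕ → UnitAddTorus (Fin 3) → EuclideanSpace ℝ (Fin 3))
      (p : ℕ → UnitAddTorus (Fin 3) → ℝ), (∀ j, 0 < ν j) →
    Filter.Tendsto ν Filter.atTop (nhds 0) →
    (∀ j, Literature.Analysis.FunctionSpaces.Torus.IsClassicalNSSolutionOn Set.univ (ν j)
      (fun _ => f) (fun _ => u j) (fun _ => p j)) →
    (∃ E : ℝ, ∀ j, ∫ x, ‖u j x‖ ^ 2 ≤ E) →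
    (∃ ε : ℝ, 0 < ε ∧ ∀ j, ε ≤ ∫ x, ⟪r x, u j x⟫_ℝ) →
    ∃ f : UnitAddTorus (Fin 3) → EuclideanSpace ℝ (Fin 3),
      Literature.Analysis.FunctionSpaces.Torus.IsSmooth f ∧
      Literature.Analysis.FunctionSpaces.Torus.IsDivFree f ∧
      Literature.Analysis.FunctionSpaces.Torus.HasZeroMean f ∧
      ∃ (ν : ℕ → ℝ) (u : ℕ → UnitAddTorus (Fin 3) → EuclideanSpace ℝ (Fin 3))
        (p : ℕ → UnitAddTorus (Fin 3) → ℝ), (∀ j, 0 < ν j) ∧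
        Filter.Tendsto ν Filter.atTop (nhds 0) ∧
        (∀ j, Literature.Analysis.FunctionSpaces.Torus.IsClassicalNSSolutionOn Set.univ (ν j)
          (fun _ => f) (fun _ => u j) (fun _ => p j)) ∧
        (∃ E : ℝ, ∀ j, MeasureTheory.integral MeasureTheory.volume (fun x => ‖u j x‖ ^ 2) ≤ E) ∧
        ∃ ε : ℝ, 0 < ε ∧
          ∀ j, ε ≤ ν j * Literature.Analysis.FunctionSpaces.Torus.gradNormSq (u j) := by
  intro f r hf hdiv hmean hproj ν u p hν hν0 hsol hE hε
  obtain ⟨E, hE⟩ := hE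
  obtain ⟨ε, hεpos, hεle⟩ := hε
  refine ⟨f, hf, hdiv, hmean, ν, u, p, hν, hν0, hsol, ⟨E, hE⟩, ε, hεpos, fun j => ?_⟩
  -- the slice `u j` of the steady state is smooth and solenoidal
  have hsm : Torus.IsSmooth (u j) :=
    (hsol j).smooth_velocity.isSmooth_slice (Set.mem_univ (0 : ℝ))
  have hdf : Torus.IsDivFree (u j) := (hsol j).divFree 0 (Set.mem_univ _)
  -- dissipation = injected power = power of `r` (projection hypothesis at `w := u j`) ≥ ε
  rw [steady_energy_identity (hsol j), hproj (u j) hsm hdf]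
  exact hεle j

end Summit.AnomalousDissipation.AnomalousDissipation.Theorems
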